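import Summits.BirchSwinnertonDyer.Rank1Residual.X2.TorsionForcesSplit
import Summits.BirchSwinnertonDyer.Rank1Residual.Partition.SemistableCurves
import Literature.NumberTheory.EllipticCurves.SemistableModPImageProofs
import Literature.NumberTheory.EllipticCurves.RationalTwoTorsionSemistableModPIrreducibleProofs
import Literature.NumberTheory.EllipticCurves.Rank1Residual.GVParityIsogenyClassProofs
import Literature.NumberTheory.EllipticCurves.Rank1Residual.ClassX1Isogeny
import Literature.NumberTheory.EllipticCurves.Rank1Residual.Dedup
import HarnessLib

/-!
# SEMISTABLE curves on the Eisenstein (reducible) rows: a rational `p`-torsion point in the isogeny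
# class (Serre 1972 Prop. 21), hence type A at every odd Eisenstein prime, X1 at every anomalous one,
# and SPLIT reduction at every multiplicative one (cell `b2b-bsdres`, unit `b2b-bsdres-lit-cgls`, s10)

HONEST FRAMING (run/shared/lean/b2b/bsd-rank1-residual/, verbatim in every file): the goal of the
cell is to DELETE the COMBINATION-SHAPED residual classes of the Birch–Swinnerton-Dyer formula for
ALL analytic-rank `≤ 1` elliptic curves over `ℚ` — "full BSD formula for every rank `≤ 1` curve in
class `C`" assembled STRICTLY from published theorems — so that the rank-`≤ 1` remainder becomes
exactly the CONSTRUCTION-SHAPED classes, which are TYPED (missing-input `Prop`s), NOT attempted.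
This is not "finishing BSD". Research routes; NO CLAIM BEYOND STATED CLASSES; nothing here changes
a label. THEOREMS ONLY (no definition, no named fact, no `sorry`); nothing about any particular
curve is asserted.

## What this file kernel-checks, and why

Serre's Prop. 21 (Invent. Math. 15 (1972) §5.4; Edixhoven 1997 Prop. 2.1 — PROVED in the tree,
`Edixhoven1997_prop_2_1_holds`): for a SEMISTABLE `E/ℚ` and a prime `p`, the mod-`p` representation is
surjective or has semisimplification `1 ⊕ χ_p`. Read through the quotient isogeny (eisenstein-p2's
`X2.IsogenyQuotientLine.exists_isogeny_ker_eq_line`, *AEC* III.4.12) exactly as the tree's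
`RationalTwoTorsionSemistableModPIrreduciblePerPrimeProofs` does for Ribet's Prop. 1, it says:

  **semistable `E`, `E[p]` reducible ⟹ `E` or the `p`-isogenous quotient `E/H` (on a globally
  minimal model) has a RATIONAL POINT OF ORDER `p`** (`exists_addOrderOf_eq_or_isogenous_of_isSemistable_of_red`).

Fed into the cell's torsion lemmas this settles, for every semistable curve, the two census bits of
the Eisenstein rows that the CLASS-CLOSURE tables carry (split / non-split; Greenberg–Vatsal type):

* §2 (X2, multiplicative `p ≥ 3`): **`hasSplitMultiplicativeReductionAtPrime_of_isSemistable_of_red`**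
  — semistable + `E[p]` reducible + multiplicative at `p ≥ 3` ⟹ SPLIT at `p` (session 10's
  `split_and_dvd_of_addOrderOf_eq_of_mult` on `E` or on `E/H`, and split/non-split is an isogeny
  invariant); **`not_gvPar_of_isSemistable_of_red_of_mult`** — ⟹ type A (`¬ GVPar`; session 9's
  torsion ⟹ type A, granted the Tate-uniformisation facts `hT`, `hT'` = A40/A41 as everywhere in the
  X2 kernel); readings on the X2 cells: `not_semistable_of_classX2_of_not_split`,
  **`not_cellA_of_semistable`** (the CLOSED Greenberg–Vatsal cell X2a contains no semistable curve),
  `cellB_of_semistable_of_classX2_of_analyticRank_eq_zero`, **`cellCSplitNotGV_of_semistable_of_cellC`**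
  (every semistable O9 cell lies in `CellCSplitNotGV`), `not_cellCNonsplitGV_of_semistable`,
  `not_cellCNonsplitNotGV_of_semistable` (no `hT`), `not_cellCSplitGV_of_semistable`. Census
  (obsanat `class-closure/{O9,N9}/pairs.tsv`, column `sst`; EVIDENCE only): O9 4 971 / 4 971 and N9
  51 / 51 semistable cells are split with `p ∣ #E(ℚ)_tors`; all 3 163 + 84 non-split cells are
  non-semistable — consistent (0 violations possible). So the verbatim-extension part
  `CellCNonsplitGV` (Disegni 2020, 1 599 cells) and route G's `CellCNonsplitNotGV` (1 564) consist of
  NON-semistable curves only, and X2a likewise.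
* §3 (X1, good anomalous `p ≠ 2`): **`not_gvPar_of_isSemistable_of_anom`** — semistable + anomalous
  ⟹ type A (x1a's `not_gvPar_of_anom_of_nsmul_eq_zero` on `E`, or its isogeny form on `E/H` with
  `Anom.of_isIsogenous`); hence **`classX1_of_semistable_of_anom`: every semistable curve is an X1
  pair at each odd anomalous Eisenstein prime, at BOTH analytic ranks** (the covered Greenberg–Vatsal
  cell C7 = `r = 0 ∧ gvpar` and the Schneider-closable N1′ = type B ∧ `r = 1` contain no semistable
  curve); and the semistable strong-partial statement sharpened: `residual_iff_anom_of_semistable_of_goodOrd`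
  — on a semistable curve at an odd good ordinary `p` the cell's residual disjunction holds IFF `p` is
  an anomalous Eisenstein prime (`Partition/SemistableCurves.lean` gave `↔ ClassX1`). Census (N1
  `SUBPARTITION.md`): all type-B rows are `non-sst`, all `sst` rows type A — consistent.

References: [Serre1972] §5.4 Prop. 21; [Edixhoven1997] Prop. 2.1; [SilvermanAEC2009] III.4.12,
VII.6.1, Ex. 7.5; [GreenbergVatsal2000] Thm. (1.3) and §2 p. 28; [Ribet1997] Prop. 1 (the template);
[Vatsal2005JIMJ] Lemma 5.2 (semistable + reducible ⟹ `χ = 1`, ordinary at `ℓ`);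
HOME/class-closure/{O9,N9,N1}/SUBPARTITION.md; HOME/b2b-bsdres-lit-cgls/CGLS-GV-TYPING.md §17.
-/

set_option autoImplicit false

noncomputable section

open scoped Classical

open WeierstrassCurve Literature.NumberTheory.EllipticCurves
  Literature.NumberTheory.EllipticCurves.ModularForms
  Literature.NumberTheory.EllipticCurves.Rank1Residual
  Literature.NumberTheory.EllipticCurves.Rank1Residual.Typed
  Literature.NumberTheory.Automorphic

namespace Summit.BirchSwinnertonDyer.Rank1Residual

/-! ## §1. Serre's Prop. 21 read as torsion: a rational point of order `p` on `E` or on `E/H` -/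

section Serre

variable (W : WeierstrassCurve ℚ) [W.IsElliptic] (p : ℕ) [hp : Fact p.Prime]

/-- **Semistable `E/ℚ` with `E[p]` reducible: `E` or its `p`-isogenous quotient has a rational point
of order `p`.** By Serre 1972 Prop. 21 / Edixhoven 1997 Prop. 2.1 (tree theorem
`Edixhoven1997_prop_2_1_holds`) the representation is surjective (excluded: reducible) or there is a
`Γ_ℚ`-stable line `H ≤ E[p]` fixed pointwise — then Galois descent gives a rational point of order `p`
on `E` (`exists_addOrderOf_eq_of_forall_smul_eq`) — or with `Γ_ℚ` trivial on `E[p]/H` — then the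
quotient isogeny `g : E → E' = E/H` onto a GLOBALLY MINIMAL model
(`X2.IsogenyQuotientLine.exists_isogeny_ker_eq_line`) carries any `T₀ ∉ H` to a `Γ_ℚ`-fixed point
of order `p`, which descends to `E'(ℚ)`. The argument is the tree's proof of Ribet 1997 Prop. 1
(`hasIrreducibleModPGaloisRep_of_isSemistable_of_rational_two_torsion_of_noTwoTorsionPrime`) without
the `2`-torsion. [cite: Serre1972, §5.4 Prop. 21] [cite: Edixhoven1997, Prop. 2.1 (PDF p. 285–286)]
[cite: SilvermanAEC2009, Prop. III.4.12 with Rem. III.4.13.2] -/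
theorem exists_addOrderOf_eq_or_isogenous_of_isSemistable_of_red (hW : W.IsSemistable ℤ)
    (hred : ¬ W.HasIrreducibleModPGaloisRep p) :
    (∃ P : W.toAffine.Point, addOrderOf P = p) ∨
      ∃ (W' : WeierstrassCurve ℚ) (_ : W'.IsElliptic) (_ : W'.IsGloballyMinimal),
        IsIsogenous W W' ∧ ∃ Q : W'.toAffine.Point, addOrderOf Q = p := by
  have hpp : p.Prime := hp.out
  haveI : NeZero (p : ℚ) := ⟨Nat.cast_ne_zero.mpr hpp.ne_zero⟩
  rcases Edixhoven1997_prop_2_1_holds W hW p hpp with hsurj | ⟨H, hstab, hbot, htop, hH⟩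
  · exact absurd (hasIrreducibleModPGaloisRep_of_hasSurjectiveModNGaloisRep W p hsurj) hred
  obtain ⟨s₀, hs₀H, hs₀0, hHeq⟩ := exists_eq_zmultiples_of_ne_bot_of_ne_top W p H hbot htop
  have hs₀0' : (s₀ : W.geomPoints) ≠ 0 := fun h ↦ hs₀0 (Subtype.ext h)
  have hmemp : ∀ x : geomTorsion W (p : ℤ), p • (x : W.geomPoints) = 0 := fun x ↦ by
    have h := (mem_torsionPoints_iff _ _ (x : W.geomPoints)).mp x.2
    rwa [natCast_zsmul] at h
  have hords₀ : addOrderOf (s₀ : W.geomPoints) = p := addOrderOf_eq_prime (hmemp s₀) hs₀0'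
  rcases hH with hfix | hquot
  · /- Case 1: `Γ_ℚ` fixes `H` pointwise: a rational point of order `p` on `E`. -/
    left
    obtain ⟨P₀, -, hoP₀⟩ := exists_addOrderOf_eq_of_forall_smul_eq W (s₀ : W.geomPoints) fun σ ↦ by
      have := hfix σ s₀ hs₀H
      simpa only [AddSubgroup.torsionBy.coe_smul] using congrArg Subtype.val this
    exact ⟨P₀, hoP₀.trans hords₀⟩
  · /- Case 2: `Γ_ℚ` acts trivially on `E[p]/H`: pass to `E' = E/H` on a globally minimal model. -/
    right
    have hline : IsRationalLine W p H := by
      refine ⟨?_, hstab⟩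
      rw [hHeq, Nat.card_zmultiples, ← AddSubgroup.addOrderOf_coe]
      exact hords₀
    obtain ⟨W', hW'e, hW'm, g, hker, -⟩ := X2.IsogenyQuotientLine.exists_isogeny_ker_eq_line hline
    obtain ⟨T₀, hT₀⟩ : ∃ T₀ : geomTorsion W (p : ℤ), T₀ ∉ H := by
      by_contra h
      push Not at h
      exact htop (eq_top_iff.mpr fun x _ ↦ h x)
    have hker' : ∀ {x : W.geomPoints},
        g x = 0 ↔ x ∈ H.map (geomTorsion W (p : ℤ)).subtype := fun {x} ↦ by
      rw [← hker, AddMonoidHom.mem_ker, Isogeny.coe_toAddMonoidHom]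
    have hgT0 : g (T₀ : W.geomPoints) ≠ 0 := fun h ↦ by
      obtain ⟨y, hy, hyT⟩ := AddSubgroup.mem_map.mp (hker'.mp h)
      exact hT₀ (Subtype.ext hyT ▸ hy)
    have hordgT : addOrderOf (g (T₀ : W.geomPoints)) = p :=
      addOrderOf_eq_prime (by rw [← map_nsmul, hmemp T₀, map_zero]) hgT0
    have hfixg : ∀ σ : Field.absoluteGaloisGroup ℚ, σ • g (T₀ : W.geomPoints) = g T₀ := by
      intro σ
      have hmem : σ • (T₀ : W.geomPoints) - T₀ ∈ H.map (geomTorsion W (p : ℤ)).subtype := by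
        refine AddSubgroup.mem_map.mpr ⟨σ • T₀ - T₀, hquot σ T₀, ?_⟩
        simp only [AddSubgroup.coe_subtype, AddSubgroup.coe_sub, AddSubgroup.torsionBy.coe_smul]
      have h0 : g (σ • (T₀ : W.geomPoints) - T₀) = 0 := hker'.mpr hmem
      rw [map_sub, sub_eq_zero] at h0
      rw [← g.map_smul, h0]
    obtain ⟨Q₀, -, hoQ₀⟩ := exists_addOrderOf_eq_of_forall_smul_eq W' (g (T₀ : W.geomPoints)) hfixg
    exact ⟨W', hW'e, hW'm, ⟨g⟩, Q₀, hoQ₀.trans hordgT⟩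

/-- The `Rank1Residual.Semistable` spelling (bridge `semistable_iff_isSemistable_int`).
[cite: Serre1972, §5.4 Prop. 21] [cite: Edixhoven1997, Prop. 2.1 (PDF p. 285–286)] -/
theorem exists_addOrderOf_eq_or_isogenous_of_semistable_of_red (hsst : Semistable W)
    (hred : Red W p) :
    (∃ P : W.toAffine.Point, addOrderOf P = p) ∨
      ∃ (W' : WeierstrassCurve ℚ) (_ : W'.IsElliptic) (_ : W'.IsGloballyMinimal),
        IsIsogenous W W' ∧ ∃ Q : W'.toAffine.Point, addOrderOf Q = p :=
  exists_addOrderOf_eq_or_isogenous_of_isSemistable_of_red W p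
    ((semistable_iff_isSemistable_int W).mp hsst) hred

end Serre

/-! ## §2. X2: semistable ⟹ split at `p` and type A -/

namespace X2

section Mult

variable (W : WeierstrassCurve ℚ) [W.IsElliptic] [W.IsGloballyMinimal] (p : ℕ) [hp : Fact p.Prime]

/-- An element of prime order is non-zero and killed by `p` (bookkeeping). [folklore] -/
private theorem ne_zero_and_nsmul_of_addOrderOf_eq {A : Type*} [AddMonoid A] {P : A}
    (hP : addOrderOf P = p) : P ≠ 0 ∧ p • P = 0 := by
  refine ⟨fun h ↦ ?_, by rw [← hP]; exact addOrderOf_nsmul_eq_zero P⟩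
  rw [h, addOrderOf_zero] at hP
  exact hp.out.one_lt.ne hP

/-- **Semistable `E/ℚ`, `E[p]` reducible, `p ≥ 3` multiplicative ⟹ SPLIT multiplicative reduction
at `p`.** The rational point of order `p` of §1 lives on `E` — then session 10's
`split_and_dvd_of_addOrderOf_eq_of_mult` — or on the `p`-isogenous globally minimal `E'`, which is
multiplicative at `p` too and hence split, and split/non-split is a `ℚ`-isogeny invariant
(`IsogenyQuotientLine.hasSplitMultiplicativeReductionAtPrime_iff_of_isIsogenous`).
[cite: Serre1972, §5.4 Prop. 21] [cite: SilvermanAEC2009, Thm. VII.6.1, Ex. 7.5 and §C.16] -/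
theorem hasSplitMultiplicativeReductionAtPrime_of_isSemistable_of_red (hp3 : 3 ≤ p)
    (hW : W.IsSemistable ℤ) (hmult : Mult W p) (hred : ¬ W.HasIrreducibleModPGaloisRep p) :
    W.HasSplitMultiplicativeReductionAtPrime p := by
  rcases exists_addOrderOf_eq_or_isogenous_of_isSemistable_of_red W p hW hred with
    ⟨P, hP⟩ | ⟨W', hW'e, hW'm, hiso, Q, hQ⟩
  · exact (split_and_dvd_of_addOrderOf_eq_of_mult W p hp3 hmult hP).1
  · exact (IsogenyQuotientLine.hasSplitMultiplicativeReductionAtPrime_iff_of_isIsogenous hiso).mpr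
      (split_and_dvd_of_addOrderOf_eq_of_mult W' p hp3
        (IsogenyQuotientLine.hasMultiplicativeReductionAtPrime_of_isIsogenous hiso hmult) hQ).1

/-- **Semistable X2 pairs are SPLIT at `p`** (`ClassX2 W p := p ≠ 2 ∧ Red ∧ Mult`).
[cite: Serre1972, §5.4 Prop. 21] [cite: SilvermanAEC2009, Thm. VII.6.1, Ex. 7.5 and §C.16] -/
theorem hasSplitMultiplicativeReductionAtPrime_of_semistable_of_classX2 (hsst : Semistable W)
    (hX : ClassX2 W p) : W.HasSplitMultiplicativeReductionAtPrime p :=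
  hasSplitMultiplicativeReductionAtPrime_of_isSemistable_of_red W p (three_le_of_ne_two hX.1)
    ((semistable_iff_isSemistable_int W).mp hsst) hX.2.2 hX.2.1

/-- **A NON-SPLIT X2 pair is never semistable** (the non-split O9 / N9 sub-cells — Disegni's
verbatim-extension part and route G's cell — consist of non-semistable curves only).
[cite: Serre1972, §5.4 Prop. 21] [cite: SilvermanAEC2009, Thm. VII.6.1, Ex. 7.5 and §C.16] -/
theorem not_semistable_of_classX2_of_not_split (hX : ClassX2 W p)
    (hns : ¬ W.HasSplitMultiplicativeReductionAtPrime p) : ¬ Semistable W := fun hsst ↦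
  hns (hasSplitMultiplicativeReductionAtPrime_of_semistable_of_classX2 W p hsst hX)

/-- **Semistable `E/ℚ`, `E[p]` reducible, odd multiplicative `p` ⟹ type A (`¬ GVPar W p`)**, granted
the Tate-uniformisation facts `hT`, `hT'`: the rational point of order `p` of §1 on `E` (session 9's
`not_gvPar_of_nsmul_eq_zero_of_mult`) or on the isogenous `E'`
(`not_gvPar_of_isIsogenous_of_nsmul_eq_zero_of_mult`). [cite: Serre1972, §5.4 Prop. 21]
[cite: GreenbergVatsal2000, Thm. (1.3) and §2 p. 28] [cite: SilvermanATAEC1994, Thm. V.5.3 and Cor. V.5.4] -/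
theorem not_gvPar_of_isSemistable_of_red_of_mult
    (hT : Silverman1994_thmV53_tateUniformisation.{0})
    (hT' : Silverman1994_thmV53_corV54_tateUniformisation.{0})
    (hp2 : p ≠ 2) (hW : W.IsSemistable ℤ) (hmult : W.HasMultiplicativeReductionAtPrime p)
    (hred : ¬ W.HasIrreducibleModPGaloisRep p) : ¬ GVPar W p := by
  rcases exists_addOrderOf_eq_or_isogenous_of_isSemistable_of_red W p hW hred with
    ⟨P, hP⟩ | ⟨W', hW'e, hW'm, hiso, Q, hQ⟩
  · obtain ⟨hP0, hpP⟩ := ne_zero_and_nsmul_of_addOrderOf_eq p hP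
    exact not_gvPar_of_nsmul_eq_zero_of_mult W hT hT' hp2 hmult P hP0 hpP
  · obtain ⟨hQ0, hpQ⟩ := ne_zero_and_nsmul_of_addOrderOf_eq p hQ
    exact not_gvPar_of_isIsogenous_of_nsmul_eq_zero_of_mult hT hT' hp2 hmult hiso Q hQ0 hpQ

/-- The `Semistable` / `ClassX2` spelling: **semistable X2 pairs are of type A.**
[cite: Serre1972, §5.4 Prop. 21] [cite: GreenbergVatsal2000, Thm. (1.3) and §2 p. 28] -/
theorem not_gvPar_of_semistable_of_classX2
    (hT : Silverman1994_thmV53_tateUniformisation.{0})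
    (hT' : Silverman1994_thmV53_corV54_tateUniformisation.{0})
    (hsst : Semistable W) (hX : ClassX2 W p) : ¬ GVPar W p :=
  not_gvPar_of_isSemistable_of_red_of_mult W p hT hT' hX.1 ((semistable_iff_isSemistable_int W).mp hsst)
    hX.2.2 hX.2.1

end Mult

/-! ### Readings on the X2 cells (N9 = `CellA ∪ CellB`, O9 = `CellC` and its four sub-cells) -/

section Cells

variable {W : WeierstrassCurve ℚ} [W.IsElliptic] [W.IsGloballyMinimal] {p : ℕ} [Fact p.Prime]

/-- **The CLOSED Greenberg–Vatsal cell X2a (`r = 0 ∧ X2 ∧ gvpar`) contains no semistable curve.**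
[cite: Serre1972, §5.4 Prop. 21] [cite: GreenbergVatsal2000, Thm. (1.3) and §2 p. 28] -/
theorem not_cellA_of_semistable
    (hT : Silverman1994_thmV53_tateUniformisation.{0})
    (hT' : Silverman1994_thmV53_corV54_tateUniformisation.{0})
    (hsst : Semistable W) : ¬ CellA W p := fun hA ↦
  not_gvPar_of_semistable_of_classX2 W p hT hT' hsst hA.2.1 hA.2.2

/-- **N9: a semistable X2 pair of analytic rank `0` is in sub-cell X2b** (type A).
[cite: Serre1972, §5.4 Prop. 21] [cite: GreenbergVatsal2000, Thm. (1.3) and §2 p. 28] -/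
theorem cellB_of_semistable_of_classX2_of_analyticRank_eq_zero
    (hT : Silverman1994_thmV53_tateUniformisation.{0})
    (hT' : Silverman1994_thmV53_corV54_tateUniformisation.{0})
    (hsst : Semistable W) (hX : ClassX2 W p) (hr0 : W.analyticRank = 0) : CellB W p :=
  ⟨hr0, hX, not_gvPar_of_semistable_of_classX2 W p hT hT' hsst hX⟩

/-- **O9: every semistable cell of X2c lies in the sub-cell `CellCSplitNotGV`** (split by
`hasSplitMultiplicativeReductionAtPrime_of_semistable_of_classX2`, ψ even by
`not_gvPar_of_semistable_of_classX2`). Census: 4 971 / 4 971 semistable O9 cells (obsanat).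
[cite: Serre1972, §5.4 Prop. 21] [cite: GreenbergVatsal2000, Thm. (1.3) and §2 p. 28] -/
theorem cellCSplitNotGV_of_semistable_of_cellC
    (hT : Silverman1994_thmV53_tateUniformisation.{0})
    (hT' : Silverman1994_thmV53_corV54_tateUniformisation.{0})
    (hsst : Semistable W) (hc : CellC W p) : CellCSplitNotGV W p :=
  ⟨hc, hasSplitMultiplicativeReductionAtPrime_of_semistable_of_classX2 W p hsst hc.2,
    not_gvPar_of_semistable_of_classX2 W p hT hT' hsst hc.2⟩

/-- A semistable X2 pair of analytic rank `≤ 1` is in X2b or in `CellCSplitNotGV` — never in X2a,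
never in a non-split or ψ-odd sub-cell of X2c. [cite: Serre1972, §5.4 Prop. 21] [cite: GreenbergVatsal2000, Thm. (1.3) and §2 p. 28] -/
theorem cellB_or_cellCSplitNotGV_of_semistable_of_classX2
    (hT : Silverman1994_thmV53_tateUniformisation.{0})
    (hT' : Silverman1994_thmV53_corV54_tateUniformisation.{0})
    (hsst : Semistable W) (hX : ClassX2 W p) (hr : W.analyticRank ≤ 1) :
    CellB W p ∨ CellCSplitNotGV W p := by
  rcases Nat.le_one_iff_eq_zero_or_eq_one.mp hr with h0 | h1
  · exact Or.inl (cellB_of_semistable_of_classX2_of_analyticRank_eq_zero hT hT' hsst hX h0)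
  · exact Or.inr (cellCSplitNotGV_of_semistable_of_cellC hT hT' hsst ⟨h1, hX⟩)

/-- The verbatim-extension sub-cell `CellCNonsplitGV` (Disegni 2020 Thm. 4, modulo Schneider)
contains no semistable curve (the split bit alone; no `hT`). [cite: Serre1972, §5.4 Prop. 21]
[cite: SilvermanAEC2009, Thm. VII.6.1, Ex. 7.5 and §C.16] -/
theorem not_cellCNonsplitGV_of_semistable (hsst : Semistable W) : ¬ CellCNonsplitGV W p := fun h ↦
  h.2.1 (hasSplitMultiplicativeReductionAtPrime_of_semistable_of_classX2 W p hsst h.1.2)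

/-- Route G's sub-cell `CellCNonsplitNotGV` contains no semistable curve (no `hT`).
[cite: Serre1972, §5.4 Prop. 21] [cite: SilvermanAEC2009, Thm. VII.6.1, Ex. 7.5 and §C.16] -/
theorem not_cellCNonsplitNotGV_of_semistable (hsst : Semistable W) : ¬ CellCNonsplitNotGV W p :=
  fun h ↦ h.2.1 (hasSplitMultiplicativeReductionAtPrime_of_semistable_of_classX2 W p hsst h.1.2)

/-- The sub-cell `CellCSplitGV` contains no semistable curve (the parity bit; granted `hT`, `hT'`).
[cite: Serre1972, §5.4 Prop. 21] [cite: GreenbergVatsal2000, Thm. (1.3) and §2 p. 28] -/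
theorem not_cellCSplitGV_of_semistable
    (hT : Silverman1994_thmV53_tateUniformisation.{0})
    (hT' : Silverman1994_thmV53_corV54_tateUniformisation.{0})
    (hsst : Semistable W) : ¬ CellCSplitGV W p := fun h ↦
  not_gvPar_of_semistable_of_classX2 W p hT hT' hsst h.1.2 h.2.2

end Cells

end X2

/-! ## §3. X1: semistable + anomalous ⟹ type A, hence X1 at both ranks -/

section Anomalous

variable (W : WeierstrassCurve ℚ) [W.IsElliptic] [W.IsGloballyMinimal] (p : ℕ) [hp : Fact p.Prime]

/-- **Semistable `E/ℚ` at an odd anomalous Eisenstein prime is of type A (`¬ GVPar W p`).** The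
rational point of order `p` of §1 lives on `E` — then x1a's `not_gvPar_of_anom_of_nsmul_eq_zero` —
or on the `p`-isogenous `E'`, which is anomalous at `p` too (`Anom.of_isIsogenous`) — then x1a's
isogeny form `not_gvPar_of_isIsogenous_of_nsmul_eq_zero`. No Tate-uniformisation input (good `p`).
[cite: Serre1972, §5.4 Prop. 21] [cite: GreenbergVatsal2000, Thm. (1.3) and §2 p. 28] -/
theorem not_gvPar_of_isSemistable_of_anom (hp2 : p ≠ 2) (hW : W.IsSemistable ℤ) (hA : Anom W p) :
    ¬ GVPar W p := by
  rcases exists_addOrderOf_eq_or_isogenous_of_isSemistable_of_red W p hW hA.1 with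
    ⟨P, hP⟩ | ⟨W', hW'e, hW'm, hiso, Q, hQ⟩
  · have hP0 : P ≠ 0 := fun h ↦ by
      rw [h, addOrderOf_zero] at hP
      exact hp.out.one_lt.ne hP
    have hpP : p • P = 0 := by rw [← hP]; exact addOrderOf_nsmul_eq_zero P
    exact not_gvPar_of_anom_of_nsmul_eq_zero W hp2 hA P hP0 hpP
  · have hQ0 : Q ≠ 0 := fun h ↦ by
      rw [h, addOrderOf_zero] at hQ
      exact hp.out.one_lt.ne hQ
    have hpQ : p • Q = 0 := by rw [← hQ]; exact addOrderOf_nsmul_eq_zero Q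
    exact not_gvPar_of_isIsogenous_of_nsmul_eq_zero hp2 hA (Anom.of_isIsogenous hiso hA) hiso Q hQ0 hpQ

/-- The `Semistable` spelling. [cite: Serre1972, §5.4 Prop. 21] [cite: GreenbergVatsal2000, Thm. (1.3) and §2 p. 28] -/
theorem not_gvPar_of_semistable_of_anom (hp2 : p ≠ 2) (hsst : Semistable W) (hA : Anom W p) :
    ¬ GVPar W p :=
  not_gvPar_of_isSemistable_of_anom W p hp2 ((semistable_iff_isSemistable_int W).mp hsst) hA

/-- **Every semistable curve is an X1 pair at each odd anomalous Eisenstein prime, at BOTH analytic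
ranks** (`ClassX1 := 2 < p ∧ Red ∧ Good ∧ Anom ∧ ¬(r_an = 0 ∧ gvpar)`, the last clause by
`not_gvPar_of_semistable_of_anom`): the covered Greenberg–Vatsal cell C7 (`r = 0 ∧ gvpar`) and the
Schneider-closable corner N1′ (type B ∧ `r = 1`) contain no semistable curve.
[cite: Serre1972, §5.4 Prop. 21] [cite: GreenbergVatsal2000, Thm. (1.3) and §2 p. 28] -/
theorem classX1_of_semistable_of_anom (hp2 : 2 < p) (hsst : Semistable W) (hA : Anom W p) :
    ClassX1 W p :=
  ⟨hp2, hA.1, hA.2.1, hA, fun h ↦ not_gvPar_of_semistable_of_anom W p hp2.ne' hsst hA h.2⟩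

/-- On a semistable curve at an odd anomalous prime, `ClassX1 W p ↔ Anom W p` (bookkeeping form).
[cite: Serre1972, §5.4 Prop. 21] [cite: GreenbergVatsal2000, Thm. (1.3) and §2 p. 28] -/
theorem classX1_iff_anom_of_semistable (hp2 : 2 < p) (hsst : Semistable W) : ClassX1 W p ↔ Anom W p :=
  ⟨fun h ↦ h.2.2.2.1, classX1_of_semistable_of_anom W p hp2 hsst⟩

end Anomalous

/-! ### The semistable strong-partial statement, sharpened: residual ⟺ anomalous Eisenstein -/

section Residual

variable {W : WeierstrassCurve ℚ} [W.IsElliptic] [W.IsGloballyMinimal] {p : ℕ} [Fact p.Prime]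

/-- **On a SEMISTABLE curve at an odd good ORDINARY prime, the cell's residual disjunction holds IFF
`p` is an anomalous Eisenstein prime** (`Residual W p ↔ Anom W p`): `Partition/SemistableCurves.lean`
gives `Residual ↔ ClassX1` granted modularity (`hBCDT`) and level-lowering (`hLL`); §3 gives
`ClassX1 ↔ Anom` on semistable curves. So on semistable curves there is no rank / parity escape from
the anomalous Eisenstein obstruction and nothing else obstructs.
[cite: SkinnerUrban2014, p. 45 (remark before Cor. 3.6.10)] [cite: Serre1972, §5.4 Prop. 21]
[cite: GreenbergVatsal2000, Thm. (1.3) and §2 p. 28] -/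
theorem residual_iff_anom_of_semistable_of_goodOrd (hBCDT : exists_isNewformOf)
    (hLL : diamond1995_refinedSerre) (hp : p ≠ 2) (hsst : Semistable W) (hord : GoodOrd W p) :
    Residual W p ↔ Anom W p := by
  have hp2 : 2 < p := lt_of_le_of_ne (Fact.out : p.Prime).two_le (Ne.symm hp)
  rw [residual_iff_classX1_of_semistable_of_goodOrd hBCDT hLL hp hsst hord]
  exact classX1_iff_anom_of_semistable W p hp2 hsst

end Residual

end Summit.BirchSwinnertonDyer.Rank1Residual

end
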